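import Literature.NumberTheory.GaloisRepresentations.ProjectiveLiftingUnramifiedProofs
import Literature.NumberTheory.GaloisRepresentations.TateProjectiveLiftingH2Proofs
import HarnessLib

/-!
# Tate's theorem `H²(Γ_F, ℚ/ℤ) = 0` in cochain form: first reductions, and its equivalence
with the `ℓ`-adic lifting theorem

Third sibling proof file of `ProjectiveLifting.lean` (named fact
`Patrikis2019_exists_lift_projective`).  Theorems only: no definition, no named fact (D-0026).

After `ProjectiveLiftingProofs.lean` / `ProjectiveLiftingUnramifiedProofs.lean` (this seat) and
`TateProjectiveLiftingH2Proofs.lean`, the named fact `Patrikis2019_exists_lift_projective`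
(Tate's lifting theorem for projective `ℓ`-adic Galois representations, with control of
ramification; Patrikis 2019, §2.1, Prop. 1.0.18 and Remark = Conrad Prop. 5.3, Lemma 5.2) is
*equivalent*, inside the tree, to Tate's theorem (Patrikis 2019, §2.1, Theorem (Tate) = arXiv
Thm. 1.0.16; Serre, Durham 1977, §6.1 Thm. 4): "Let `F` be a number field. Then
`H²(Γ_F, ℚ/ℤ) = 0`", rendered on locally constant inhomogeneous cochains —
`Patrikis2019_exists_lift_projective_iff_H2_addCircle` below.  Tate's theorem is global class
field theory and is not available in Mathlib or in this tree; this file starts its printed proof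
(Patrikis, proof of Thm. 1.0.16, first sentence: "It suffices to prove
`H²(Γ_F, ℚ_p/ℤ_p) = 0` for all primes `p` … Since `H²(Γ_F, ℚ_p/ℤ_p)` is `p`-power torsion, to
show it is zero we may instead show that multiplication by `p` is injective"), in cochain form
and for an arbitrary compact group `Γ`:

* `addCircle_nsmul_surjective` — `ℚ/ℤ` is divisible;
* `addCircle_twoCocycle_split_of_prime_torsion` — **reduction to prime torsion**: if for every
  prime `p` every locally constant `p`-torsion `2`-cocycle `Γ × Γ → ℚ/ℤ` is the coboundary of a
  locally constant `ℚ/ℤ`-valued cochain, then so is every locally constant `2`-cocycle (induction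
  on an exponent `N` killing the cocycle: split `N' • f`, `N = p N'`, divide the splitting cochain
  by `N'` in the divisible group `ℚ/ℤ`, and descend to an `N'`-torsion cocycle);
* `Patrikis2019_exists_lift_projective_of_prime_torsion` — hence the named fact follows from the
  prime-torsion case of Tate's theorem for every number field, which is the statement
  "`H²(Γ_F, ℤ/p) → H²(Γ_F, ℚ/ℤ)` is zero", i.e. the surjectivity of
  `δ : H¹(Γ_F, ℚ/ℤ) → H²(Γ_F, ℤ/p)` of the printed proof (there: `≅ Br(F)[p]` once `μ_p ⊂ F`,
  then the local–global structure of the Brauer group — not in this tree).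

## References

* S. Patrikis, *Variations on a theorem of Tate*, Mem. Amer. Math. Soc. 258 (2019), no. 1238,
  §2.1, Theorem (Tate) (= arXiv:1207.6724 Thm. 1.0.16) and the first paragraph of its proof;
  Prop. 1.0.18 and Remark. [`Patrikis2019`]
* J.-P. Serre, *Modular forms of weight one and Galois representations* (Durham 1977), §6.1
  Thm. 4, §6.5. [`SerreDurham1977`]
-/

noncomputable section

open scoped NumberField
open Field IsDedekindDomain

namespace Literature.NumberTheory.GaloisRepresentations

/-! ### Reduction of the vanishing of `H²(Γ, ℚ/ℤ)` to prime-torsion cocycles -/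

section PrimeTorsion

/-- `ℚ/ℤ = AddCircle (1 : ℚ)` is divisible: multiplication by `N ≠ 0` is onto. [folklore] -/
theorem addCircle_nsmul_surjective {N : ℕ} (hN : N ≠ 0) :
    Function.Surjective fun x : AddCircle (1 : ℚ) => N • x := by
  intro x
  obtain ⟨q, rfl⟩ := QuotientAddGroup.mk_surjective x
  refine ⟨((q / N : ℚ) : AddCircle (1 : ℚ)), ?_⟩
  show N • ((q / N : ℚ) : AddCircle (1 : ℚ)) = ((q : ℚ) : AddCircle (1 : ℚ))
  rw [← AddCircle.coe_nsmul, nsmul_eq_mul, mul_div_cancel₀ _ (Nat.cast_ne_zero.2 hN)]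

variable {Γ : Type*} [Group Γ] [TopologicalSpace Γ] [ContinuousMul Γ] [CompactSpace Γ]

omit [CompactSpace Γ] in
/-- Inductive step carrier for `addCircle_twoCocycle_split_of_prime_torsion`: cocycles killed by
`N` split, by strong induction on `N ≥ 1`. [folklore] -/
private theorem addCircle_twoCocycle_split_of_nsmul_eq_zero
    (H : ∀ p : ℕ, p.Prime → ∀ g : Γ → Γ → AddCircle (1 : ℚ),
      IsLocallyConstant (Function.uncurry g) →
      (∀ σ τ υ, g σ τ + g (σ * τ) υ = g τ υ + g σ (τ * υ)) →
      (∀ σ τ, p • g σ τ = 0) →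
      ∃ b : Γ → AddCircle (1 : ℚ), IsLocallyConstant b ∧ ∀ σ τ, g σ τ + b (σ * τ) = b σ + b τ)
    (N : ℕ) :
    ∀ f : Γ → Γ → AddCircle (1 : ℚ), 0 < N → IsLocallyConstant (Function.uncurry f) →
      (∀ σ τ υ, f σ τ + f (σ * τ) υ = f τ υ + f σ (τ * υ)) → (∀ σ τ, N • f σ τ = 0) →
      ∃ b : Γ → AddCircle (1 : ℚ), IsLocallyConstant b ∧ ∀ σ τ, f σ τ + b (σ * τ) = b σ + b τ := by
  induction N using Nat.strong_induction_on with
  | _ N ih =>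
  intro f hN hf hcoc hNf
  by_cases h1 : N = 1
  · subst h1
    refine ⟨fun _ => 0, IsLocallyConstant.const 0, fun σ τ => ?_⟩
    have h := hNf σ τ
    rw [one_nsmul] at h
    rw [h, add_zero]
  -- `N = p N'` with `p` the least prime factor
  set p := N.minFac with hpdef
  have hp : p.Prime := Nat.minFac_prime h1
  obtain ⟨N', hNN'⟩ := Nat.minFac_dvd N
  rw [← hpdef] at hNN'
  have hN'pos : 0 < N' := by
    rcases Nat.eq_zero_or_pos N' with h0 | h0
    · rw [h0, mul_zero] at hNN'
      omega
    · exact h0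
  have hN'lt : N' < N := by
    have h2 := hp.two_le
    rw [hNN']
    nlinarith
  -- the `p`-torsion cocycle `N' • f` splits by hypothesis
  obtain ⟨b, hb, hbg⟩ := H p hp (fun σ τ => N' • f σ τ) (hf.comp fun x => N' • x)
    (fun σ τ υ => by rw [← nsmul_add, ← nsmul_add, hcoc])
    (fun σ τ => by rw [smul_smul, ← hNN', hNf])
  -- divide the splitting cochain by `N'` in the divisible group `ℚ/ℤ`
  obtain ⟨s, hs⟩ : ∃ s : AddCircle (1 : ℚ) → AddCircle (1 : ℚ), ∀ x, N' • s x = x :=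
    ⟨Function.surjInv (addCircle_nsmul_surjective hN'pos.ne'),
      fun x => Function.surjInv_eq (addCircle_nsmul_surjective hN'pos.ne') x⟩
  have hb' : IsLocallyConstant fun σ => s (b σ) := hb.comp s
  -- the corrected cocycle `f' = f - δ(s ∘ b)` is `N'`-torsion
  have hlc1 : IsLocallyConstant fun q : Γ × Γ => s (b q.1) := hb'.comp_continuous continuous_fst
  have hlc2 : IsLocallyConstant fun q : Γ × Γ => s (b q.2) := hb'.comp_continuous continuous_snd
  have hlc3 : IsLocallyConstant fun q : Γ × Γ => s (b (q.1 * q.2)) :=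
    hb'.comp_continuous (continuous_fst.mul continuous_snd)
  have hf' : IsLocallyConstant (Function.uncurry fun σ τ =>
      f σ τ + s (b (σ * τ)) - s (b σ) - s (b τ)) :=
    ((hf.add hlc3).sub hlc1).sub hlc2
  have hcoc' : ∀ σ τ υ,
      (f σ τ + s (b (σ * τ)) - s (b σ) - s (b τ)) +
        (f (σ * τ) υ + s (b (σ * τ * υ)) - s (b (σ * τ)) - s (b υ)) =
      (f τ υ + s (b (τ * υ)) - s (b τ) - s (b υ)) +
        (f σ (τ * υ) + s (b (σ * (τ * υ))) - s (b σ) - s (b (τ * υ))) := by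
    intro σ τ υ
    have h := hcoc σ τ υ
    rw [mul_assoc]
    calc (f σ τ + s (b (σ * τ)) - s (b σ) - s (b τ)) +
          (f (σ * τ) υ + s (b (σ * (τ * υ))) - s (b (σ * τ)) - s (b υ))
        = (f σ τ + f (σ * τ) υ) + (s (b (σ * (τ * υ))) - s (b σ) - s (b τ) - s (b υ)) := by
          abel
      _ = (f τ υ + f σ (τ * υ)) + (s (b (σ * (τ * υ))) - s (b σ) - s (b τ) - s (b υ)) := by
          rw [h]
      _ = _ := by abel
  have hN'f' : ∀ σ τ, N' • (f σ τ + s (b (σ * τ)) - s (b σ) - s (b τ)) = 0 := by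
    intro σ τ
    rw [nsmul_sub, nsmul_sub, nsmul_add, hs, hs, hs, hbg σ τ]
    abel
  obtain ⟨b'', hb'', hsplit⟩ := ih N' hN'lt _ hN'pos hf' hcoc' hN'f'
  refine ⟨fun σ => b'' σ + s (b σ), hb''.add hb', fun σ τ => ?_⟩
  have h := hsplit σ τ
  calc f σ τ + (b'' (σ * τ) + s (b (σ * τ)))
      = (f σ τ + s (b (σ * τ)) - s (b σ) - s (b τ) + b'' (σ * τ)) + (s (b σ) + s (b τ)) := by
        abel
    _ = b'' σ + b'' τ + (s (b σ) + s (b τ)) := by rw [h]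
    _ = b'' σ + s (b σ) + (b'' τ + s (b τ)) := by abel

/-- **Reduction of `H²(Γ, ℚ/ℤ) = 0` to prime-torsion cocycles** (the first sentence of the
printed proof of Tate's theorem, Patrikis 2019, proof of Thm. 1.0.16: "It suffices to prove
`H²(Γ_F, ℚ_p/ℤ_p) = 0` for all primes `p` … Since `H²(Γ_F, ℚ_p/ℤ_p)` is `p`-power torsion, to
show it is zero we may instead show that multiplication by `p` is injective, or equivalently that
the boundary map `δ : H¹(Γ_F, ℚ_p/ℤ_p) → H²(Γ_F, ℤ/p)` is surjective"), for an arbitrary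
compact group `Γ` and in cochain form: if for every prime `p` every locally constant `2`-cocycle
`g : Γ × Γ → ℚ/ℤ` with `p • g = 0` is the coboundary of a locally constant `ℚ/ℤ`-valued cochain
(i.e. `H²(Γ, ℤ/p) → H²(Γ, ℚ/ℤ)` vanishes), then every locally constant `2`-cocycle
`f : Γ × Γ → ℚ/ℤ` is the coboundary of a locally constant cochain.  (A locally constant `f` on
the compact `Γ × Γ` is killed by some `N ≥ 1`; induct on `N = p N'`: split `N' • f`, divide the
splitting cochain by `N'` in `ℚ/ℤ`, and pass to the `N'`-torsion cocycle `f − δ(b/N')`.)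
[cite: Patrikis2019, §2.1 proof of Theorem (Tate) = arXiv Thm. 1.0.16, first paragraph] -/
theorem addCircle_twoCocycle_split_of_prime_torsion
    (H : ∀ p : ℕ, p.Prime → ∀ g : Γ → Γ → AddCircle (1 : ℚ),
      IsLocallyConstant (Function.uncurry g) →
      (∀ σ τ υ, g σ τ + g (σ * τ) υ = g τ υ + g σ (τ * υ)) →
      (∀ σ τ, p • g σ τ = 0) →
      ∃ b : Γ → AddCircle (1 : ℚ), IsLocallyConstant b ∧ ∀ σ τ, g σ τ + b (σ * τ) = b σ + b τ)
    (f : Γ → Γ → AddCircle (1 : ℚ)) (hf : IsLocallyConstant (Function.uncurry f))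
    (hcoc : ∀ σ τ υ, f σ τ + f (σ * τ) υ = f τ υ + f σ (τ * υ)) :
    ∃ b : Γ → AddCircle (1 : ℚ), IsLocallyConstant b ∧ ∀ σ τ, f σ τ + b (σ * τ) = b σ + b τ := by
  obtain ⟨N, hN, hNf⟩ := addCircle_exists_nsmul_comp_eq_zero (Function.uncurry f) hf.range_finite
  exact addCircle_twoCocycle_split_of_nsmul_eq_zero H N f hN hf hcoc fun σ τ => hNf (σ, τ)

end PrimeTorsion

/-! ### The named fact and Tate's theorem -/

section NumberField

/-- **`Patrikis2019_exists_lift_projective` is equivalent to Tate's theorem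
`H²(Γ_F, ℚ/ℤ) = 0` (all number fields `F`) in cochain form.**  (⇐) is
`Patrikis2019_exists_lift_projective_of_H2_addCircle` (the printed deduction
Thm. 1.0.16 ⟹ Prop. 1.0.18 + Remark, `ProjectiveLiftingProofs.lean`,
`ProjectiveLiftingUnramifiedProofs.lean`); (⇒) is `twoCocycle_addCircle_split_of_Patrikis2019`
(`TateProjectiveLiftingH2Proofs.lean`: every class of `H²(Γ_F, ℚ/ℤ)` is the obstruction class
of a projective representation).  So the one input of the named fact missing from the tree is
exactly Tate's theorem (Patrikis Thm. 1.0.16 = Serre, Durham, Thm. 4: global class field theory).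
[cite: Patrikis2019, §2.1 Theorem (Tate) = arXiv Thm. 1.0.16, Prop. 1.0.18 and Remark] -/
theorem Patrikis2019_exists_lift_projective_iff_H2_addCircle :
    Patrikis2019_exists_lift_projective ↔
      ∀ (F : Type) [Field F] [NumberField F]
        (f : absoluteGaloisGroup F → absoluteGaloisGroup F → AddCircle (1 : ℚ)),
        IsLocallyConstant (Function.uncurry f) →
        (∀ σ τ υ, f σ τ + f (σ * τ) υ = f τ υ + f σ (τ * υ)) →
        ∃ b : absoluteGaloisGroup F → AddCircle (1 : ℚ), IsLocallyConstant b ∧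
          ∀ σ τ, f σ τ + b (σ * τ) = b σ + b τ :=
  ⟨fun hP F _ _ f hf hcoc => twoCocycle_addCircle_split_of_Patrikis2019 hP F f hf hcoc,
    fun hTate => Patrikis2019_exists_lift_projective_of_H2_addCircle hTate⟩

/-- **`Patrikis2019_exists_lift_projective` from the prime-torsion case of Tate's theorem.**
If for every number field `F` and every prime `p`, every locally constant `p`-torsion
`2`-cocycle `Γ_F × Γ_F → ℚ/ℤ` is the coboundary of a locally constant `ℚ/ℤ`-valued cochain
("multiplication by `p` is injective on `H²(Γ_F, ℚ/ℤ)`", equivalently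
"`δ : H¹(Γ_F, ℚ/ℤ) → H²(Γ_F, ℤ/p)` is surjective" — the statement the printed proof of
Thm. 1.0.16 establishes from the local–global structure of the Brauer group), then the named
fact holds (`addCircle_twoCocycle_split_of_prime_torsion` +
`Patrikis2019_exists_lift_projective_of_H2_addCircle`).
[cite: Patrikis2019, §2.1 Theorem (Tate) = arXiv Thm. 1.0.16 (proof, first paragraph), Prop. 1.0.18 and Remark] -/
theorem Patrikis2019_exists_lift_projective_of_prime_torsion
    (H : ∀ (F : Type) [Field F] [NumberField F] (p : ℕ), p.Prime →
      ∀ g : absoluteGaloisGroup F → absoluteGaloisGroup F → AddCircle (1 : ℚ),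
      IsLocallyConstant (Function.uncurry g) →
      (∀ σ τ υ, g σ τ + g (σ * τ) υ = g τ υ + g σ (τ * υ)) →
      (∀ σ τ, p • g σ τ = 0) →
      ∃ b : absoluteGaloisGroup F → AddCircle (1 : ℚ), IsLocallyConstant b ∧
        ∀ σ τ, g σ τ + b (σ * τ) = b σ + b τ) :
    Patrikis2019_exists_lift_projective :=
  Patrikis2019_exists_lift_projective_of_H2_addCircle fun F _ _ f hf hcoc =>
    addCircle_twoCocycle_split_of_prime_torsion (H F) f hf hcoc

end NumberField

end Literature.NumberTheory.GaloisRepresentations
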